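import Summits.ABC.ABC.Theorems.SomeWindowSaving.Negative.TwistDefs
import Summits.ABC.ABC.Theorems.SomeWindowSaving.Negative.TwistCovariants
import Summits.ABC.ABC.Theorems.SomeWindowSaving.Negative.FreyFamilyWindow

/-!
# The twisted Frey family lies in the crux's window slices

Negative-side support (cdisprove of stmt-ABC-1976): for `0 < κ`, `σ > 12`, primes `p ≥ p₁`,
`d > 4p²` with the lower-edge inequality `(2¹³ p³ d²)^κ ≤ 13824000 p¹² d⁶` and `X ≥ 2¹³ p³ d²`,
`twistFamily p d ∈ windowSet κ σ X` (`twistFamily_mem_windowSet`): `p d² ∣ N ≤ 2¹³ p³ d²`,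
`M⁺ = d⁶ · M⁺(freyFamily p) ∈ [13824000 p¹² d⁶, 2²⁴ p¹² d⁶]`.
-/

noncomputable section

open UniqueFactorizationMonoid IsDedekindDomain Real WeierstrassCurve Rat.HeightOneSpectrum
open Literature.NumberTheory.EllipticCurves

namespace Summit.ABC.ABC.Theorems.SomeWindowSaving.Negative

section TwistFamily

variable {p d : ℕ}

/-- A prime `d > 4p²` does not divide `AB(A+B) = (4p² − 1) · 4p²`. -/
theorem not_dvd_freyFamily_prod (hp : p.Prime) (hp3 : ¬ 3 ∣ p) (hd : d.Prime) (hpd : 4 * p ^ 2 < d) :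
    ¬ (d : ℤ) ∣ 1 * (3 * kOf p) * (1 + 3 * kOf p) := by
  obtain ⟨hn, hK⟩ := natAbs_freyFamily_prod hp3 hp.one_le
  intro h
  have h' : d ∣ 3 * (kOf p).natAbs * (4 * p ^ 2) := by rw [← hn]; exact Int.natCast_dvd.mp h
  rcases (Nat.Prime.dvd_mul hd).mp h' with h1 | h1
  · have := Nat.le_of_dvd (by omega) h1
    omega
  · rcases (Nat.Prime.dvd_mul hd).mp h1 with h2 | h2
    · have := Nat.le_of_dvd (by norm_num) h2
      have : 4 ≤ 4 * p ^ 2 := by nlinarith [hp.one_le]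
      omega
    · have h3 : d ∣ p := hd.dvd_of_dvd_pow h2
      have := Nat.le_of_dvd hp.pos h3
      nlinarith [hp.one_le]

/-- Conductor bounds for the twisted family: `p d² ∣ N` and `N ≤ 2¹³ p³ d²`, for any twisting
prime `d ≥ 5` not dividing `AB(A+B) = 4p²(4p² − 1)`. -/
theorem conductorNorm_twistFamily_bounds' (hp : p.Prime) (h5 : 5 ≤ p) (hd : d.Prime) (hd5 : 5 ≤ d)
    (hdM : ¬ (d : ℤ) ∣ 1 * (3 * kOf p) * (1 + 3 * kOf p)) :
    p * d ^ 2 ∣ ((twistFamily p d).baseChange ℚ).conductorNorm ℤ ∧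
      ((twistFamily p d).baseChange ℚ).conductorNorm ℤ ≤ 2 ^ 13 * p ^ 3 * d ^ 2 := by
  have hp3 := not_three_dvd_of_prime hp h5
  have hodd := odd_of_prime_of_five_le hp h5
  have hp1 := hp.one_le
  have h0 := freyFamily_prod_ne_zero hp3 hp1
  have h16 := not_sixteen_dvd_freyFamily_prod hp3 hodd
  have hc₄ := twistFamily_c₄ p d
  have hΔ := twistFamily_Δ p d
  have hpM : (p : ℤ) ∣ 1 * (3 * kOf p) * (1 + 3 * kOf p) := by
    rw [three_mul_kOf hp3]
    exact Dvd.intro (4 * (p : ℤ) * (4 * (p : ℤ) ^ 2 - 1)) (by ring)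
  have hpd' : p ≠ d := by rintro rfl; exact hdM hpM
  constructor
  · refine Nat.Coprime.mul_dvd_of_dvd_of_dvd ?_ ?_ ?_
    · exact ((Nat.coprime_primes hp hd).mpr hpd').pow_right 2
    · exact dvd_conductorNorm_of_twistCovariants isCoprime_one_left h0 h16 hd hd5 hdM hc₄ hΔ hp
        (by omega) hpM
    · exact sq_dvd_conductorNorm_of_twistCovariants isCoprime_one_left h0 h16 hd hd5 hdM hc₄ hΔ
  · have h := conductorNorm_dvd_of_twistCovariants isCoprime_one_left h0 h16 hd hd5 hdM hc₄ hΔ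
    have hr := radical_freyFamily_prod_le hp3 hp1
    calc ((twistFamily p d).baseChange ℚ).conductorNorm ℤ
        ≤ 2 ^ 10 * radical ((1 : ℤ) * (3 * kOf p) * (1 + 3 * kOf p)).natAbs * d ^ 2 :=
          Nat.le_of_dvd (by positivity) h
      _ ≤ 2 ^ 10 * (8 * p ^ 3) * d ^ 2 := by gcongr
      _ = 2 ^ 13 * p ^ 3 * d ^ 2 := by ring

/-- Conductor bounds for the twisted family, `d > 4p²` version: `p d² ∣ N` and `N ≤ 2¹³ p³ d²`. -/
theorem conductorNorm_twistFamily_bounds (hp : p.Prime) (h5 : 5 ≤ p) (hd : d.Prime)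
    (hpd : 4 * p ^ 2 < d) :
    p * d ^ 2 ∣ ((twistFamily p d).baseChange ℚ).conductorNorm ℤ ∧
      ((twistFamily p d).baseChange ℚ).conductorNorm ℤ ≤ 2 ^ 13 * p ^ 3 * d ^ 2 :=
  conductorNorm_twistFamily_bounds' hp h5 hd (by nlinarith)
    (not_dvd_freyFamily_prod hp (not_three_dvd_of_prime hp h5) hd hpd)

/-- `M⁺ (twist) ∈ [13824000 p¹² d⁶, 2²⁴ p¹² d⁶]`. -/
theorem maxInv_twistFamily_bounds (hp3 : ¬ 3 ∣ p) (h2 : 2 ≤ p) (d : ℕ) :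
    13824000 * (p : ℤ) ^ 12 * (d : ℤ) ^ 6 ≤ max |(twistFamily p d).Δ| (|(twistFamily p d).c₄| ^ 3) ∧
      max |(twistFamily p d).Δ| (|(twistFamily p d).c₄| ^ 3) ≤ 2 ^ 24 * (p : ℤ) ^ 12 * (d : ℤ) ^ 6 := by
  obtain ⟨hlo, hhi⟩ := maxInv_freyFamily_bounds hp3 h2
  obtain ⟨hc₄, hΔ⟩ := twistFamily_c₄_Δ_eq p d
  have hd0 : (0 : ℤ) ≤ (d : ℤ) ^ 6 := by positivity
  have hmax : max |(twistFamily p d).Δ| (|(twistFamily p d).c₄| ^ 3) =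
      (d : ℤ) ^ 6 * max |(freyFamily p).Δ| (|(freyFamily p).c₄| ^ 3) := by
    have e : ((d : ℤ) ^ 2) ^ 3 = (d : ℤ) ^ 6 := by ring
    rw [hc₄, hΔ, abs_mul, abs_mul, mul_pow, abs_of_nonneg hd0,
      abs_of_nonneg (by positivity : (0 : ℤ) ≤ (d : ℤ) ^ 2), e, ← mul_max_of_nonneg _ _ hd0]
  rw [hmax]
  constructor
  · calc 13824000 * (p : ℤ) ^ 12 * (d : ℤ) ^ 6 = (d : ℤ) ^ 6 * (13824000 * (p : ℤ) ^ 12) := by ring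
      _ ≤ _ := by gcongr
  · calc (d : ℤ) ^ 6 * max |(freyFamily p).Δ| (|(freyFamily p).c₄| ^ 3)
        ≤ (d : ℤ) ^ 6 * (2 ^ 24 * (p : ℤ) ^ 12) := by gcongr
      _ = 2 ^ 24 * (p : ℤ) ^ 12 * (d : ℤ) ^ 6 := by ring

/-- **The twisted family sits in the windows.**  For `0 < κ`, `σ > 12`: every pair of primes
`p ≥ p₁`, `d ≥ 5` with `d ∤ 4p²(4p²−1)` satisfying the lower-edge inequality
`(2¹³ p³ d²)^κ ≤ 13824000 p¹² d⁶` (i.e. `d ≲ p^{(12−3κ)/(2κ−6)}`) gives a member `twistFamily p d`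
of `windowSet κ σ X` for every `X ≥ 2¹³ p³ d²`. -/
theorem twistFamily_mem_windowSet' {κ σ : ℝ} (hκ0 : 0 < κ) (hσ : 12 < σ) :
    ∃ p₁ : ℕ, 5 ≤ p₁ ∧ ∀ p d : ℕ, p.Prime → d.Prime → p₁ ≤ p → 5 ≤ d →
      ¬ (d : ℤ) ∣ 1 * (3 * kOf p) * (1 + 3 * kOf p) →
      ((2 : ℝ) ^ 13 * (p : ℝ) ^ 3 * (d : ℝ) ^ 2) ^ κ ≤ 13824000 * (p : ℝ) ^ 12 * (d : ℝ) ^ 6 →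
      ∀ X : ℝ, (2 : ℝ) ^ 13 * (p : ℝ) ^ 3 * (d : ℝ) ^ 2 ≤ X → twistFamily p d ∈ windowSet κ σ X := by
  obtain ⟨p₁, hp₁⟩ := upper_window_ineq hσ
  refine ⟨max 5 p₁, le_max_left _ _, fun p d hp hd hge hd5 hdM hlow X hX ↦ ?_⟩
  have h5 : 5 ≤ p := le_of_max_le_left hge
  have hge₁ : p₁ ≤ p := le_of_max_le_right hge
  have hp3 := not_three_dvd_of_prime hp h5
  have hp1 : 1 ≤ p := hp.one_le
  have hd1 : (1 : ℝ) ≤ d := by exact_mod_cast hd.one_le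
  haveI hE : ((twistFamily p d).baseChange ℚ).IsElliptic :=
    isElliptic_of_twistCovariants (freyFamily_prod_ne_zero hp3 hp1) hd (twistFamily_Δ p d)
  obtain ⟨hNdvd, hNle⟩ := conductorNorm_twistFamily_bounds' hp h5 hd hd5 hdM
  have hNle' : ((((twistFamily p d).baseChange ℚ).conductorNorm ℤ : ℕ) : ℝ) ≤
      (2 : ℝ) ^ 13 * (p : ℝ) ^ 3 * (d : ℝ) ^ 2 := by exact_mod_cast hNle
  have hNge : (p : ℝ) * (d : ℝ) ^ 2 ≤ ((((twistFamily p d).baseChange ℚ).conductorNorm ℤ : ℕ) : ℝ) := by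
    exact_mod_cast Nat.le_of_dvd (conductorNorm_pos_holds _) hNdvd
  obtain ⟨hMlo, hMhi⟩ := maxInv_twistFamily_bounds hp3 (by omega) d
  have hMlo' : (13824000 : ℝ) * (p : ℝ) ^ 12 * (d : ℝ) ^ 6 ≤
      ((max |(twistFamily p d).Δ| (|(twistFamily p d).c₄| ^ 3) : ℤ) : ℝ) := by exact_mod_cast hMlo
  have hMhi' : ((max |(twistFamily p d).Δ| (|(twistFamily p d).c₄| ^ 3) : ℤ) : ℝ) ≤
      (2 : ℝ) ^ 24 * (p : ℝ) ^ 12 * (d : ℝ) ^ 6 := by exact_mod_cast hMhi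
  have hk := one_le_kOf hp3 hp1
  have hc₄0 : (twistFamily p d).c₄ ≠ 0 := by
    rw [(twistFamily_c₄_Δ_eq p d).1]
    exact mul_ne_zero (pow_ne_zero _ (by exact_mod_cast hd.ne_zero)) (freyFamily_c₄_pos hp3 hp1).ne'
  have hc₆0 : (twistFamily p d).c₆ ≠ 0 := by
    rw [twistFamily_c₆]
    have h1 : (0 : ℤ) < 3 * kOf p - 1 := by omega
    have h2 : (0 : ℤ) < 3 * kOf p + 2 := by omega
    have h3 : (0 : ℤ) < 6 * kOf p + 1 := by omega
    exact mul_ne_zero (mul_ne_zero (by norm_num) (pow_ne_zero _ (by exact_mod_cast hd.ne_zero)))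
      (mul_pos (mul_pos h1 h2) h3).ne'
  have ha₂ := redShift_spec ((d : ℤ) * (3 * kOf p - 1))
  refine ⟨hE, isMinimalAt_of_twistCovariants isCoprime_one_left (freyFamily_prod_ne_zero hp3 hp1)
      (not_sixteen_dvd_freyFamily_prod hp3 (odd_of_prime_of_five_le hp h5)) hd hd5
      hdM (twistFamily_c₄ p d) (twistFamily_Δ p d),
    Or.inl rfl, Or.inl rfl, ha₂, hc₄0, hc₆0, hNle'.trans hX, ?_, ?_⟩
  · calc ((((twistFamily p d).baseChange ℚ).conductorNorm ℤ : ℕ) : ℝ) ^ κ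
        ≤ ((2 : ℝ) ^ 13 * (p : ℝ) ^ 3 * (d : ℝ) ^ 2) ^ κ := Real.rpow_le_rpow (by positivity) hNle' hκ0.le
      _ ≤ 13824000 * (p : ℝ) ^ 12 * (d : ℝ) ^ 6 := hlow
      _ ≤ _ := hMlo'
  · have hd6 : (d : ℝ) ^ 6 ≤ ((d : ℝ) ^ 2) ^ σ := by
      have h1 : (1 : ℝ) ≤ (d : ℝ) ^ 2 := one_le_pow₀ hd1
      calc (d : ℝ) ^ 6 = ((d : ℝ) ^ 2) ^ (3 : ℝ) := by
            rw [show ((d : ℝ) ^ 2) ^ (3 : ℝ) = ((d : ℝ) ^ 2) ^ (3 : ℕ) from Real.rpow_natCast _ 3]; ring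
        _ ≤ ((d : ℝ) ^ 2) ^ σ := Real.rpow_le_rpow_of_exponent_le h1 (by linarith)
    calc ((max |(twistFamily p d).Δ| (|(twistFamily p d).c₄| ^ 3) : ℤ) : ℝ)
        ≤ (2 : ℝ) ^ 24 * (p : ℝ) ^ 12 * (d : ℝ) ^ 6 := hMhi'
      _ ≤ (p : ℝ) ^ σ * ((d : ℝ) ^ 2) ^ σ := by
          rw [show (2 : ℝ) ^ 24 * (p : ℝ) ^ 12 * (d : ℝ) ^ 6 = ((2 : ℝ) ^ 24 * (p : ℝ) ^ 12) * (d : ℝ) ^ 6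
            by ring]
          exact mul_le_mul (hp₁ p hge₁) hd6 (by positivity) (by positivity)
      _ = ((p : ℝ) * (d : ℝ) ^ 2) ^ σ := (Real.mul_rpow (by positivity) (by positivity)).symm
      _ ≤ ((((twistFamily p d).baseChange ℚ).conductorNorm ℤ : ℕ) : ℝ) ^ σ :=
          Real.rpow_le_rpow (by positivity) hNge (by linarith)

/-- **The twisted family sits in the windows**, `d > 4p²` version (then `d ∤ 4p²(4p²−1)`
automatically). -/
theorem twistFamily_mem_windowSet {κ σ : ℝ} (hκ0 : 0 < κ) (hσ : 12 < σ) :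
    ∃ p₁ : ℕ, 5 ≤ p₁ ∧ ∀ p d : ℕ, p.Prime → d.Prime → p₁ ≤ p → 4 * p ^ 2 < d →
      ((2 : ℝ) ^ 13 * (p : ℝ) ^ 3 * (d : ℝ) ^ 2) ^ κ ≤ 13824000 * (p : ℝ) ^ 12 * (d : ℝ) ^ 6 →
      ∀ X : ℝ, (2 : ℝ) ^ 13 * (p : ℝ) ^ 3 * (d : ℝ) ^ 2 ≤ X → twistFamily p d ∈ windowSet κ σ X := by
  obtain ⟨p₁, h5, hmem⟩ := twistFamily_mem_windowSet' hκ0 hσ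
  refine ⟨p₁, h5, fun p d hp hd hge hpd hlow X hX ↦ hmem p d hp hd hge ?_ ?_ hlow X hX⟩
  · have : 5 ≤ p := h5.trans hge
    nlinarith
  · exact not_dvd_freyFamily_prod hp (not_three_dvd_of_prime hp (h5.trans hge)) hd hpd

end TwistFamily

end Summit.ABC.ABC.Theorems.SomeWindowSaving.Negative
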